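import Summits.QuantumFields.YangMills.Theorems.VirialFluxGapResolventFieldPointwise
import HarnessLib

/-!
# Route `VirialFluxGap` (YangMills): the RESOLVENT EULER FIELD — the deficit-level CUT-OFF has the good sign

Toward the deciding crux `VirialFluxGap.PeriodicSoftness` (item stmt-QuantumFields-24141), generic-region Euler field (memo v2, step (C)).  By
✓`FrameHessian.sum_frameD_resolventCoeff` the divergence of the cut-off resolvent field `φ_j = χ·½(A⁻¹g)_j` is
`Σ_j ∂_{τ_j}χ·½(A⁻¹g)_j + χ·(½tr(A⁻¹H) − …)`.  For the DEFICIT-LEVEL cut-off `χ = ψ(F₀/t₀)` with `ψ` smooth and non-increasing the first term is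
`(ψ′(F₀/t₀)/(2t₀))·gᵀA⁻¹g ≤ 0` — it only LOWERS the divergence (as LEAD g92 ∕ w3 g58 anticipated for `χ′·(X·F₀) ≤ 0`):

* `frameD_comp_deriv` — chain rule `∂_Y(ψ ∘ f) = ψ′(f)·∂_Y f` for smooth `ψ : ℝ → ℝ`, `f : ((Fin (2 * L - 1 + 1) → Edge 3 L → Matrix (Fin 2) (Fin 2) ℂ) × (Site 3 L → Matrix (Fin 2) (Fin 2) ℂ)) → ℝ`;
* `frameD_deficitCutoff` — `∂_{τ_j}[ψ(ringPoly/t₀)] = ψ′(ringPoly/t₀)/t₀ · g_j`;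
* ★★ `deficitCutoff_term_nonpos` — `Σ_j ∂_{τ_j}[ψ(ringPoly/t₀)]·½(A⁻¹g)_j = (ψ′/(2t₀))·gᵀA⁻¹g ≤ 0` whenever `ψ′ ≤ 0` at the point and `A = H + λ⋆`
  has a positive floor (✓`ResolventField.inv_form_nonneg`).

HONEST FRAMING: a small plumbing letter; the regular-region cut-off against the central charts (patching term C4), the central charts and the
assembly are NOT here; ⟨24141⟩ stays OPEN; no stub / crux / rung / summit is closed; the Yang–Mills mass gap is NOT proved; no summit is proved by
a line.  THEOREMS ONLY (0 `def`, 0 `sorry`), standard axioms.  Explicit-unit seat `ym-line-fcl-p3` g40 (cell ym-idea-1, free hands),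
`--supports stmt-QuantumFields-24141`.  References: [folklore].
-/

set_option autoImplicit false

noncomputable section

open scoped Matrix BigOperators ContDiff Topology
open MeasureTheory Set Matrix
open Literature.MathematicalPhysics.QuantumFieldTheory hiding SU2
open Literature.MathematicalPhysics.QuantumLattice
open Literature.MathematicalPhysics.QuantumFieldTheory.SUNBakryEmery (expSU coe_expSU matTop)

namespace Summit.QuantumFields.YangMills.Theorems.VirialFluxGap.FrameHessian

open Summit.QuantumFields.YangMills.Theorems.FemtoTransferGap
open Summit.QuantumFields.YangMills.Theorems.FemtoTransferGap.TT
open Summit.QuantumFields.YangMills.Theorems.VirialFluxGap.RingDeficit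
open Summit.QuantumFields.YangMills.Theorems.VirialFluxGap.FrameDerivative
open Summit.QuantumFields.YangMills.Theorems.VirialFluxGap.ResolventField

variable {L : ℕ} [NeZero L]
variable {ι : Type*} [Fintype ι] [DecidableEq ι]

open scoped Matrix.Norms.Frobenius

attribute [local instance 2000] Literature.MathematicalPhysics.QuantumFieldTheory.SUNBakryEmery.matTop

omit [Fintype ι] [DecidableEq ι] in
/-- Chain rule for frame derivatives through a smooth scalar function: `∂_Y(ψ ∘ f)(M) = ψ′(f M)·∂_Y f(M)`. [folklore] -/
theorem frameD_comp_deriv {ψ : ℝ → ℝ} (hψ : ContDiff ℝ ∞ ψ) {f : ((Fin (2 * L - 1 + 1) → Edge 3 L → Matrix (Fin 2) (Fin 2) ℂ) × (Site 3 L → Matrix (Fin 2) (Fin 2) ℂ)) → ℝ} (hf : ContDiff ℝ ∞ f)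
    (Y : ((Fin (2 * L - 1 + 1) × Edge 3 L) ⊕ Site 3 L) → Matrix (Fin 2) (Fin 2) ℂ) (M : ((Fin (2 * L - 1 + 1) → Edge 3 L → Matrix (Fin 2) (Fin 2) ℂ) × (Site 3 L → Matrix (Fin 2) (Fin 2) ℂ))) :
    frameD Y (fun M' => ψ (f M')) M = deriv ψ (f M) * frameD Y f M := by
  have h1 : HasDerivAt ψ (deriv ψ (f M)) (f M) := ((hψ.differentiable (by simp)) (f M)).hasDerivAt
  have h2 : HasFDerivAt f (fderiv ℝ f M) M := ((hf.differentiable (by simp)) M).hasFDerivAt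
  have h : HasFDerivAt (fun M' => ψ (f M')) (deriv ψ (f M) • fderiv ℝ f M) M := h1.comp_hasFDerivAt M h2
  rw [frameD, frameD, h.fderiv, FunLike.coe_smul, Pi.smul_apply, smul_eq_mul]

omit [Fintype ι] [DecidableEq ι] in
/-- The frame derivatives of the deficit-level cut-off `ψ(ringPoly/t₀)`: `ψ′(ringPoly M/t₀)/t₀ · g_j(M)`. [folklore] -/
theorem frameD_deficitCutoff {ψ : ℝ → ℝ} (hψ : ContDiff ℝ ∞ ψ) {t₀ : ℝ} (τ : ι → ((Fin (2 * L - 1 + 1) × Edge 3 L) ⊕ Site 3 L) → Matrix (Fin 2) (Fin 2) ℂ) (j : ι) (M : ((Fin (2 * L - 1 + 1) → Edge 3 L → Matrix (Fin 2) (Fin 2) ℂ) × (Site 3 L → Matrix (Fin 2) (Fin 2) ℂ))) :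
    frameD (τ j) (fun M' => ψ (ringPoly L M' / t₀)) M = deriv ψ (ringPoly L M / t₀) / t₀ * frameGrad (L := L) τ M j := by
  have hf : ContDiff ℝ ∞ fun M' : ((Fin (2 * L - 1 + 1) → Edge 3 L → Matrix (Fin 2) (Fin 2) ℂ) × (Site 3 L → Matrix (Fin 2) (Fin 2) ℂ)) => ringPoly L M' / t₀ := (contDiff_ringPoly (L := L)).div_const t₀
  rw [frameD_comp_deriv hψ hf]
  have hdiv : frameD (τ j) (fun M' : ((Fin (2 * L - 1 + 1) → Edge 3 L → Matrix (Fin 2) (Fin 2) ℂ) × (Site 3 L → Matrix (Fin 2) (Fin 2) ℂ)) => ringPoly L M' / t₀) M = frameD (τ j) (ringPoly L) M / t₀ := by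
    have e : (fun M' : ((Fin (2 * L - 1 + 1) → Edge 3 L → Matrix (Fin 2) (Fin 2) ℂ) × (Site 3 L → Matrix (Fin 2) (Fin 2) ℂ)) => ringPoly L M' / t₀) = fun M' => t₀⁻¹ * ringPoly L M' := by funext M'; ring
    rw [e, frameD, frameD]
    have hd : HasFDerivAt (fun M' : ((Fin (2 * L - 1 + 1) → Edge 3 L → Matrix (Fin 2) (Fin 2) ℂ) × (Site 3 L → Matrix (Fin 2) (Fin 2) ℂ)) => t₀⁻¹ * ringPoly L M') (t₀⁻¹ • fderiv ℝ (ringPoly L) M) M :=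
      (((contDiff_ringPoly (L := L)).differentiable (by simp)) M).hasFDerivAt.const_mul t₀⁻¹
    rw [hd.fderiv, FunLike.coe_smul, Pi.smul_apply, smul_eq_mul]
    ring
  rw [hdiv, frameGrad]
  ring

/-- ★★ **The deficit-level cut-off term has the good sign.**  If `ψ′(ringPoly M/t₀) ≤ 0`, `t₀ > 0`, and `A = H(M) + λ⋆` has a positive floor
`c`, then `Σ_j ∂_{τ_j}[ψ(ringPoly/t₀)](M)·½(A⁻¹g)_j = (ψ′/(2t₀))·gᵀA⁻¹g ≤ 0`. [folklore] -/
theorem deficitCutoff_term_nonpos {ψ : ℝ → ℝ} (hψ : ContDiff ℝ ∞ ψ) {t₀ : ℝ} (ht₀ : 0 < t₀) (τ : ι → ((Fin (2 * L - 1 + 1) × Edge 3 L) ⊕ Site 3 L) → Matrix (Fin 2) (Fin 2) ℂ)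
    (lam : ℝ) (M : ((Fin (2 * L - 1 + 1) → Edge 3 L → Matrix (Fin 2) (Fin 2) ℂ) × (Site 3 L → Matrix (Fin 2) (Fin 2) ℂ))) (hψ' : deriv ψ (ringPoly L M / t₀) ≤ 0) {c : ℝ} (hc : 0 < c)
    (hfl : ∀ v, c * (v ⬝ᵥ v) ≤ v ⬝ᵥ ((frameHess (L := L) τ M + lam • (1 : Matrix ι ι ℝ)) *ᵥ v)) :
    ∑ j, frameD (τ j) (fun M' => ψ (ringPoly L M' / t₀)) M *
        ((1 / 2) * (((frameHess (L := L) τ M + lam • (1 : Matrix ι ι ℝ))⁻¹ *ᵥ frameGrad (L := L) τ M) j)) ≤ 0 := by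
  have hform : 0 ≤ frameGrad (L := L) τ M ⬝ᵥ ((frameHess (L := L) τ M + lam • (1 : Matrix ι ι ℝ))⁻¹ *ᵥ frameGrad (L := L) τ M) :=
    inv_form_nonneg hc hfl _
  have e : ∑ j, frameD (τ j) (fun M' => ψ (ringPoly L M' / t₀)) M *
        ((1 / 2) * (((frameHess (L := L) τ M + lam • (1 : Matrix ι ι ℝ))⁻¹ *ᵥ frameGrad (L := L) τ M) j)) =
      deriv ψ (ringPoly L M / t₀) / (2 * t₀) *
        (frameGrad (L := L) τ M ⬝ᵥ ((frameHess (L := L) τ M + lam • (1 : Matrix ι ι ℝ))⁻¹ *ᵥ frameGrad (L := L) τ M)) := by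
    simp only [frameD_deficitCutoff hψ, dotProduct, Finset.mul_sum]
    refine Finset.sum_congr rfl fun j _ => ?_
    field_simp
  rw [e]
  have hcoef : deriv ψ (ringPoly L M / t₀) / (2 * t₀) ≤ 0 := div_nonpos_of_nonpos_of_nonneg hψ' (by linarith)
  exact mul_nonpos_of_nonpos_of_nonneg hcoef hform

end Summit.QuantumFields.YangMills.Theorems.VirialFluxGap.FrameHessian

end
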